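import Literature.NumberTheory.NumberFields.ClassGroupExtension
import Literature.NumberTheory.NumberFields.AmbiguousClassGaloisAction
import Literature.NumberTheory.GaloisRepresentations.CyclicNormIndex
import Literature.NumberTheory.GaloisRepresentations.MinkowskiUnits
import HarnessLib

/-!
# Invariant ideals of an unramified cyclic extension are extended (`𝓘_L^G = 𝓘_K`), and the
# invariant principal ideals: `π{a : σa/a ∈ 𝓞_Lˣ} = P_L ∩ ι𝓘_K`

Topic `NumberTheory/NumberFields`.  Theorem-only file (no definition, no named fact); first half of the
tree's proof of Hilbert's Theorem 94 (`HilbertTheorem94.lean`), following M. Rosen, *Remarks on the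
history of Fermat's last theorem 1844 to 1984* (Cornell–Silverman–Stevens 1997), Appendix, proof of
Theorem A2: "the kernel of `Cl_K → Cl_L` is `P_L^G/P_K` … since `L/K` is unramified, `D_L^G = im(D_K)`".
As in the tree's class field theory files everything lives in the ambient groups `Lˣ` and
`𝓘_L = (FractionalIdeal (𝓞 L)⁰ L)ˣ` (`Herbrand.z0`; the Galois action of `AmbiguousClassGaloisAction`)
with the homomorphisms `π : Lˣ → 𝓘_L` (`a ↦ (a)`, kernel `E = 𝓞_Lˣ`) and the injective extension map
`ι = i_{L/K} : 𝓘_K → 𝓘_L` (Mathlib `FractionalIdeal.extendedHom`, `ClassGroupExtension.lean`).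

* `exists_eq_map_of_smul_eq` — **in an extension unramified at all finite primes every nonzero ideal
  of `𝓞_L` invariant under a generator of `Gal(L/K)` is extended from `𝓞_K`** (peel off, below an
  invariant `I ≤ 𝔔`, the whole orbit `𝔮𝓞_L = ∏_{𝔔' ∣ 𝔮} 𝔔'`; Noetherian induction).
* `ker_toPrincipalIdeal_eq_unitsE` (`ker π = 𝓞_Lˣ`), `smul_unitsMap_extendedHom` (extended ideals are
  invariant), `map_extendedHom_principals_eq` (`ιP_K = πKˣ`), `map_z0_unitsE_eq` — **the invariant
  principal ideals are exactly the principal extended ideals**, `π{a : σa/a ∈ E} = P_L ∩ ι𝓘_K`.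

## References

* M. Rosen, *Remarks on the history of Fermat's last theorem 1844 to 1984*, in *Modular Forms and
  Fermat's Last Theorem* (1997), Appendix, Thm. A2 with proof (held copy, PDF pp. 613–614). [Rosen1997FLT]
* J. Neukirch, *Algebraic Number Theory* (1999), Ch. III §1 Prop. (1.6). [NeukirchANT1999]
* D. Hilbert, *Die Theorie der algebraischen Zahlkörper* (1897), Satz 93–94. [Hilbert1897]
-/

noncomputable section

open NumberField IsDedekindDomain FractionalIdeal
open scoped nonZeroDivisors Pointwise

namespace Literature.NumberTheory.NumberFields

open Literature.NumberTheory.GaloisRepresentations Literature.NumberTheory.GaloisRepresentations.Herbrand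
  Literature.NumberTheory.GaloisRepresentations.MinkowskiUnit
  Literature.NumberTheory.GaloisRepresentations.CyclicNormIndex
  Literature.NumberTheory.NumberFields.AmbiguousClass

/-! ### Invariant ideals of an unramified extension are extended -/

section Invariant

variable {K L : Type*} [Field K] [Field L] [Algebra K L]

/-- An automorphism of `L/K` fixes the elements of `𝓞_L` coming from `𝓞_K`. [folklore] -/
private theorem smul_algebraMap_ringOfIntegers (σ : L ≃ₐ[K] L) (t : 𝓞 K) :
    σ • algebraMap (𝓞 K) (𝓞 L) t = algebraMap (𝓞 K) (𝓞 L) t :=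
  RingOfIntegers.ext (σ.commutes (t : K))

/-- An automorphism of `L/K` fixes every ideal of `𝓞_L` extended from `𝓞_K`. [folklore] -/
private theorem smul_map_algebraMap (σ : L ≃ₐ[K] L) (𝔞 : Ideal (𝓞 K)) :
    σ • 𝔞.map (algebraMap (𝓞 K) (𝓞 L)) = 𝔞.map (algebraMap (𝓞 K) (𝓞 L)) := by
  rw [Ideal.pointwise_smul_def, Ideal.map_map]
  congr 1
  exact RingHom.ext fun t => smul_algebraMap_ringOfIntegers σ t

variable [NumberField L]

/-- Peeling an invariant proper factor `M ⊇ I` off a nonzero invariant ideal `I` leaves a strictly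
larger nonzero invariant ideal (as in the tree's
`LinnikCubicClassGroupsPureCubicClassNumberHardStubInvariantIdealsPrincipal`). [folklore] -/
private theorem exists_eq_mul_of_le_of_smul_eq (σ : L ≃ₐ[K] L) {I M : Ideal (𝓞 L)} (hI : I ≠ ⊥)
    (hM : M ≠ ⊤) (hMinv : σ • M = M) (hinv : σ • I = I) (hle : I ≤ M) :
    ∃ J : Ideal (𝓞 L), I = M * J ∧ I < J ∧ J ≠ ⊥ ∧ σ • J = J := by
  obtain ⟨J, rfl⟩ := Ideal.dvd_iff_le.mpr hle
  have hM0 : M ≠ ⊥ := fun h => hI (by rw [h, Ideal.bot_mul])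
  have hJ0 : J ≠ ⊥ := fun h => hI (by rw [h, Ideal.mul_bot])
  refine ⟨J, rfl, ?_, hJ0, ?_⟩
  · refine lt_of_le_of_ne Ideal.mul_le_left (fun h => hM ?_)
    have : M * J = ⊤ * J := by rw [h, Ideal.top_mul]
    exact mul_right_cancel₀ hJ0 this
  · have h := hinv
    rw [smul_mul', hMinv] at h
    exact mul_left_cancel₀ hM0 h

variable [NumberField K]

/-- **One Galois orbit of unramified primes.**  If `I ≠ 0` is invariant under a generator `σ` of
`Gal(L/K)` and `I ≤ 𝔔` for a prime `𝔔` of `𝓞_L` unramified over `𝔮 = 𝔔 ∩ 𝓞_K`, then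
`I ≤ 𝔮𝓞_L = ∏_{𝔔' ∣ 𝔮} 𝔔'` (transitivity of the Galois group on the primes over `𝔮`; as in the
tree's `LinnikCubicClassGroupsPureCubicClassNumberHardStubInvariantIdealsPrincipal`). [folklore] -/
private theorem le_map_under_of_smul_eq' [IsGalois K L] (σ : L ≃ₐ[K] L)
    (hσ : ∀ τ : L ≃ₐ[K] L, τ ∈ Subgroup.zpowers σ) {I Q : Ideal (𝓞 L)} (hI : I ≠ ⊥)
    (hQ : Q.IsMaximal) (he : Q.ramificationIdx (𝓞 K) = 1) (hinv : σ • I = I) (hIQ : I ≤ Q) :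
    I ≤ (Q.under (𝓞 K)).map (algebraMap (𝓞 K) (𝓞 L)) := by
  classical
  haveI : (Q.under (𝓞 K)).IsMaximal := Ideal.IsMaximal.under (𝓞 K) Q
  haveI := hQ.isPrime
  have hQ0 : Q ≠ ⊥ := fun h => hI (le_bot_iff.mp (h ▸ hIQ))
  have hq0 : Q.under (𝓞 K) ≠ ⊥ := mt Ideal.eq_bot_of_comap_eq_bot hQ0
  haveI hQq : Q.LiesOver (Q.under (𝓞 K)) := ⟨rfl⟩
  have hτI : ∀ τ : L ≃ₐ[K] L, τ • I = I := fun τ =>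
    MulAction.mem_stabilizer_iff.mp
      ((Subgroup.zpowers_le.mpr (MulAction.mem_stabilizer_iff.mpr hinv)) (hσ τ))
  rw [Ideal.map_algebraMap_eq_finsetProd_pow (R := 𝓞 L) hq0, ← Ideal.dvd_iff_le]
  refine Finset.prod_dvd_of_coprime ?_ ?_
  · intro Q₁ hQ₁ Q₂ hQ₂ hne
    rw [Finset.mem_coe, Set.mem_toFinset] at hQ₁ hQ₂
    haveI h1 : Q₁.IsMaximal := hQ₁.1.isMaximal (Ideal.ne_bot_of_mem_primesOver hq0 hQ₁)
    haveI h2 : Q₂.IsMaximal := hQ₂.1.isMaximal (Ideal.ne_bot_of_mem_primesOver hq0 hQ₂)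
    exact (Ideal.isCoprime_of_isMaximal hne).pow
  · intro Q' hQ'
    rw [Set.mem_toFinset] at hQ'
    haveI := hQ'.1
    haveI := hQ'.2
    obtain ⟨τ, rfl⟩ := Ideal.exists_smul_eq_of_isGaloisGroup (Q.under (𝓞 K)) Q Q' (L ≃ₐ[K] L)
    rw [Ideal.ramificationIdx_smul, he, pow_one, Ideal.dvd_iff_le, ← hτI τ]
    exact smul_mono_right τ hIQ

/-- **`𝓘_L^G = 𝓘_K` for an unramified extension (integral ideals).**  If `L/K` is Galois with
group generated by `σ` and unramified at every finite prime of `K`, then every nonzero `σ`-invariant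
ideal of `𝓞_L` is the extension `𝔞𝓞_L` of an ideal `𝔞` of `𝓞_K` (Rosen: "since `L/K` is
unramified, `D_L^G = im(D_K)`"). [cite: Rosen1997FLT, Appendix, proof of Thm. A2] -/
theorem exists_eq_map_of_smul_eq [IsGalois K L] (σ : L ≃ₐ[K] L)
    (hσ : ∀ τ : L ≃ₐ[K] L, τ ∈ Subgroup.zpowers σ)
    (hunr : ∀ v : HeightOneSpectrum (𝓞 K), Algebra.IsUnramifiedIn (𝓞 L) v.asIdeal)
    (I : Ideal (𝓞 L)) (hI : I ≠ ⊥) (hinv : σ • I = I) :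
    ∃ 𝔞 : Ideal (𝓞 K), I = 𝔞.map (algebraMap (𝓞 K) (𝓞 L)) := by
  induction I using IsNoetherian.induction with
  | hgt I ih =>
    by_cases hI1 : I = ⊤
    · exact ⟨⊤, by rw [hI1, Ideal.map_top]⟩
    obtain ⟨Q, hQ, hIQ⟩ := Ideal.exists_le_maximal I hI1
    haveI := hQ.isPrime
    have hQ0 : Q ≠ ⊥ := fun h => hI (le_bot_iff.mp (h ▸ hIQ))
    have hq0 : Q.under (𝓞 K) ≠ ⊥ := mt Ideal.eq_bot_of_comap_eq_bot hQ0
    haveI : (Q.under (𝓞 K)).IsPrime := Ideal.IsPrime.under (𝓞 K) Q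
    -- `Q` is unramified over `𝔮 = Q ∩ 𝓞_K`
    have he : Q.ramificationIdx (𝓞 K) = 1 :=
      (hunr ⟨Q.under (𝓞 K), inferInstance, hq0⟩).ramificationIdx_eq_one ⟨rfl⟩
    have hle := le_map_under_of_smul_eq' σ hσ hI hQ he hinv hIQ
    set M := (Q.under (𝓞 K)).map (algebraMap (𝓞 K) (𝓞 L)) with hM
    have hMtop : M ≠ ⊤ := fun h =>
      hQ.ne_top (top_le_iff.mp (h ▸ (Ideal.map_le_iff_le_comap.mpr le_rfl : M ≤ Q)))
    obtain ⟨J, hIJ, hlt, hJ0, hJinv⟩ :=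
      exists_eq_mul_of_le_of_smul_eq σ hI hMtop (smul_map_algebraMap σ _) hinv hle
    obtain ⟨𝔟, h𝔟⟩ := ih J hlt hJ0 hJinv
    exact ⟨Q.under (𝓞 K) * 𝔟, by rw [Ideal.map_mul, ← hM, ← h𝔟, hIJ]⟩

end Invariant

/-! ### The three homomorphisms `π : Lˣ → 𝓘_L`, `σ − 1`, `ι : 𝓘_K → 𝓘_L` -/

section Maps

variable {K L : Type*} [Field K] [Field L] [NumberField K] [NumberField L] [Algebra K L]

/-- **`ker (a ↦ (a)) = 𝓞_Lˣ`** inside `Lˣ`: exactness at `K^*` of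
`1 → 𝒪^* → K^* → J_K → Cl_K → 1`. [cite: NeukirchANT1999, Ch. I §3 (exact sequence after Cor. (3.9), p. 22)] -/
theorem ker_toPrincipalIdeal_eq_unitsE :
    (toPrincipalIdeal (𝓞 L) L).ker = unitsE L := by
  ext x
  rw [MonoidHom.mem_ker, ← (toPrincipalIdeal (𝓞 L) L).map_one, toPrincipalIdeal_eq_iff,
    coe_toPrincipalIdeal, Units.val_one, spanSingleton_eq_spanSingleton, mem_unitsE_iff]
  constructor
  · rintro ⟨z, hz⟩
    refine ⟨z⁻¹, ?_⟩
    rw [map_inv]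
    apply Units.ext
    rw [Units.val_inv_eq_inv_val]
    have hz' : ((Units.map (algebraMap (𝓞 L) L : 𝓞 L →* L) z : Lˣ) : L) * (x : L) = 1 := by
      rw [← hz, Units.smul_def, Algebra.smul_def]; rfl
    exact (eq_inv_of_mul_eq_one_right hz').symm
  · rintro ⟨w, rfl⟩
    refine ⟨w⁻¹, ?_⟩
    rw [Units.coe_map, MonoidHom.coe_coe, Units.smul_def, Algebra.smul_def, ← map_mul, Units.inv_mul,
      map_one]

/-- Extended fractional ideals are `Gal(L/K)`-invariant: `σ • ι(J) = ι(J)`. [folklore] -/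
private theorem smul_unitsMap_extendedHom (σ : L ≃ₐ[K] L) (J : (FractionalIdeal (𝓞 K)⁰ K)ˣ) :
    σ • Units.map (extendedHom L (𝓞 L) :
        FractionalIdeal (𝓞 K)⁰ K →+* FractionalIdeal (𝓞 L)⁰ L).toMonoidHom J =
      Units.map (extendedHom L (𝓞 L) :
        FractionalIdeal (𝓞 K)⁰ K →+* FractionalIdeal (𝓞 L)⁰ L).toMonoidHom J := by
  -- the `𝓞_L`-span of a `σ`-fixed set is `σ`-stable
  have key : ∀ (τ : L ≃ₐ[K] L) (x : L),
      x ∈ (extendedHom L (𝓞 L) (J : FractionalIdeal (𝓞 K)⁰ K) : FractionalIdeal (𝓞 L)⁰ L) →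
      τ x ∈ (extendedHom L (𝓞 L) (J : FractionalIdeal (𝓞 K)⁰ K) : FractionalIdeal (𝓞 L)⁰ L) := by
    intro τ x hx
    rw [← FractionalIdeal.mem_coe, coe_extendedHom_eq_span] at hx ⊢
    refine Submodule.span_induction (p := fun y _ => τ y ∈ Submodule.span (𝓞 L) _) ?_ ?_ ?_ ?_ hx
    · rintro y ⟨z, hz, rfl⟩
      refine Submodule.subset_span ⟨z, hz, ?_⟩
      exact (τ.commutes z).symm
    · rw [map_zero]; exact Submodule.zero_mem _
    · intro y y' _ _ hy hy'
      rw [map_add]; exact Submodule.add_mem _ hy hy'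
    · intro r y _ hy
      rw [Algebra.smul_def, map_mul]
      have hr : τ (algebraMap (𝓞 L) L r) = algebraMap (𝓞 L) L (AmbiguousClass.intAut τ r) := rfl
      rw [hr, ← Algebra.smul_def]
      exact Submodule.smul_mem _ _ hy
  apply Units.ext
  apply le_antisymm
  · intro x hx
    rw [coe_smul_fracIdeal, mem_fracIdealAut_iff] at hx
    have := key σ _ hx
    rwa [AlgEquiv.apply_symm_apply] at this
  · intro x hx
    rw [coe_smul_fracIdeal, mem_fracIdealAut_iff]
    exact key σ.symm x hx

end Maps

/-! ### The invariant principal ideals `π{a : σa/a ∈ 𝓞_Lˣ} = P_L ∩ ι𝓘_K` -/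

section Count

variable (K L : Type) [Field K] [NumberField K] [Field L] [NumberField L] [Algebra K L]

/-- The map of fraction fields induced by `𝓞_K → 𝓞_L` is the given `K → L` (plumbing for Mathlib's
`extendedHom_spanSingleton`). [folklore] -/
private theorem isFractionRing_map_eq_algebraMap :
    (IsFractionRing.map (FaithfulSMul.algebraMap_injective (𝓞 K) (𝓞 L)) : K →+* L) =
      algebraMap K L := by
  apply IsLocalization.ringHom_ext (nonZeroDivisors (𝓞 K))
  ext a
  simp only [RingHom.coe_comp, Function.comp_apply, IsFractionRing.map, IsLocalization.map_eq]
  exact (IsScalarTower.algebraMap_apply (𝓞 K) (𝓞 L) L a).symm.trans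
    (IsScalarTower.algebraMap_apply (𝓞 K) K L a)

/-- **`(k)𝓞_L = (k)`** for `k ∈ K` (Neukirch (1.6)(v); Mathlib `extendedHom_spanSingleton`).
[cite: NeukirchANT1999, Ch. III §1 Prop. (1.6) (v)] -/
theorem extendedHom_spanSingleton_eq (x : K) :
    extendedHom L (𝓞 L) (spanSingleton (𝓞 K)⁰ x) = spanSingleton (𝓞 L)⁰ (algebraMap K L x) := by
  rw [extendedHom_spanSingleton, isFractionRing_map_eq_algebraMap]

/-- `ι(P_K) = π(Kˣ)`: the extension of a principal ideal `(k)` of `K` is the principal ideal of `L`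
generated by `k` (Neukirch (1.6)(v)). [cite: NeukirchANT1999, Ch. III §1 Prop. (1.6) (v)] -/
theorem map_extendedHom_principals_eq :
    (principals K).map (Units.map (extendedHom L (𝓞 L) :
        FractionalIdeal (𝓞 K)⁰ K →+* FractionalIdeal (𝓞 L)⁰ L).toMonoidHom) =
      ((unitsIncl K L).range).map (toPrincipalIdeal (𝓞 L) L) := by
  rw [MonoidHom.map_range, MonoidHom.map_range]
  congr 1
  ext k : 1
  apply Units.ext
  rw [MonoidHom.comp_apply, MonoidHom.comp_apply, Units.coe_map, coe_toPrincipalIdeal,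
    coe_toPrincipalIdeal, RingHom.toMonoidHom_eq_coe, MonoidHom.coe_coe, extendedHom_spanSingleton_eq,
    coe_unitsIncl]

variable {K L}

/-- A principal ideal `(y)` of `L` with `σy/y ∈ 𝓞_Lˣ` (i.e. invariant under a generator `σ` of
`Gal(L/K)`) is extended from `K` when `L/K` is unramified at the finite primes: clear denominators
`w = d·y ∈ 𝓞_L`, `d ∈ ℤ`, so that `(w) ⊆ 𝓞_L` is an invariant ideal, `= 𝔞𝓞_L`, and
`(y) = ι((d)⁻¹𝔞)`. [cite: Rosen1997FLT, Appendix, proof of Thm. A2] -/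
theorem toPrincipalIdeal_mem_range_of_mem_z0 [IsGalois K L] {σ : L ≃ₐ[K] L}
    (hσ : ∀ τ : L ≃ₐ[K] L, τ ∈ Subgroup.zpowers σ)
    (hunr : ∀ v : HeightOneSpectrum (𝓞 K), Algebra.IsUnramifiedIn (𝓞 L) v.asIdeal) {y : Lˣ}
    (hy : y ∈ z0 σ ⊤ (unitsE L)) :
    toPrincipalIdeal (𝓞 L) L y ∈ (Units.map (extendedHom L (𝓞 L) :
        FractionalIdeal (𝓞 K)⁰ K →+* FractionalIdeal (𝓞 L)⁰ L).toMonoidHom).range := by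
  classical
  obtain ⟨-, he⟩ := mem_z0.mp hy
  obtain ⟨e, he⟩ := mem_unitsE_iff.mp he
  -- clear denominators: `w = d • y ∈ 𝓞_L`
  obtain ⟨d, hd, hdy⟩ := exists_integral_multiples ℤ ℚ ({(y : L)} : Finset L)
  have hint : IsIntegral ℤ ((d : L) * y) := by
    have h := hdy (y : L) (Finset.mem_singleton_self _)
    rwa [Algebra.smul_def, algebraMap_int_eq, eq_intCast] at h
  set w : 𝓞 L := ⟨(d : L) * y, (mem_integralClosure_iff ℤ L).2 hint⟩ with hwdef
  have hwL : (w : L) = (d : L) * y := rfl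
  have hd0 : (d : L) ≠ 0 := by exact_mod_cast hd
  have hw0 : w ≠ 0 := by
    intro h
    have : (w : L) = 0 := by rw [h]; rfl
    rw [hwL] at this
    exact (mul_ne_zero hd0 y.ne_zero) this
  -- `σ w = e w`, so `(w)` is invariant
  have hσy : σ (y : L) = (e : 𝓞 L) * (y : L) := by
    have h := congrArg (fun u : Lˣ => (u : L)) he
    simp only [Units.coe_map, MonoidHom.coe_coe, Units.val_div_eq_div_val, coe_smul_units] at h
    rw [eq_div_iff y.ne_zero] at h
    exact h.symm
  have hσw : σ • w = (e : 𝓞 L) * w := by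
    apply RingOfIntegers.ext
    change σ (w : L) = ((e : 𝓞 L) : L) * (w : L)
    rw [hwL, map_mul, map_intCast, hσy]
    ring
  have hWinv : σ • Ideal.span {w} = Ideal.span {w} := by
    rw [Ideal.pointwise_smul_def, Ideal.map_span, Set.image_singleton]
    change Ideal.span {σ • w} = Ideal.span {w}
    rw [hσw, Ideal.span_singleton_eq_span_singleton]
    exact ⟨e⁻¹, by rw [mul_comm, ← mul_assoc, Units.inv_mul, one_mul]⟩
  have hW0 : Ideal.span {w} ≠ ⊥ := by rwa [Ne, Ideal.span_singleton_eq_bot]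
  obtain ⟨𝔞, h𝔞⟩ := exists_eq_map_of_smul_eq σ hσ hunr _ hW0 hWinv
  have h𝔞0 : 𝔞 ≠ ⊥ := by
    rintro rfl
    rw [Ideal.map_bot] at h𝔞
    exact hW0 h𝔞
  -- the fractional ideals
  set ι := (Units.map (extendedHom L (𝓞 L) :
        FractionalIdeal (𝓞 K)⁰ K →+* FractionalIdeal (𝓞 L)⁰ L).toMonoidHom) with hι
  set dK : Kˣ := Units.mk0 (d : K) (by exact_mod_cast hd) with hdK
  have h1 : ι (toPrincipalIdeal (𝓞 K) K dK) = toPrincipalIdeal (𝓞 L) L (unitsIncl K L dK) := by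
    apply Units.ext
    rw [hι, Units.coe_map, coe_toPrincipalIdeal, coe_toPrincipalIdeal, RingHom.toMonoidHom_eq_coe,
      MonoidHom.coe_coe, extendedHom_spanSingleton_eq, coe_unitsIncl]
  have h2 : (ι (FractionalIdeal.mk0 K ⟨𝔞, mem_nonZeroDivisors_of_ne_zero h𝔞0⟩) :
      FractionalIdeal (𝓞 L)⁰ L) = spanSingleton (𝓞 L)⁰ (w : L) := by
    rw [hι, Units.coe_map, RingHom.toMonoidHom_eq_coe, MonoidHom.coe_coe, FractionalIdeal.coe_mk0,
      extendedHom_coeIdeal_eq_map, ← h𝔞, coeIdeal_span_singleton]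
  have h3 : toPrincipalIdeal (𝓞 L) L (unitsIncl K L dK * y) =
      ι (FractionalIdeal.mk0 K ⟨𝔞, mem_nonZeroDivisors_of_ne_zero h𝔞0⟩) := by
    apply Units.ext
    rw [coe_toPrincipalIdeal, h2, Units.val_mul, coe_unitsIncl, hdK, Units.val_mk0, hwL,
      map_intCast]
  refine ⟨(toPrincipalIdeal (𝓞 K) K dK)⁻¹ *
    FractionalIdeal.mk0 K ⟨𝔞, mem_nonZeroDivisors_of_ne_zero h𝔞0⟩, ?_⟩
  rw [map_mul, map_inv, ← h3, h1, map_mul, inv_mul_cancel_left]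

/-- **The invariant principal ideals are the principal extended ideals**: for `L/K` Galois with
`Gal(L/K) = ⟨σ⟩`, unramified at the finite primes, `π({a ∈ Lˣ : σa/a ∈ 𝓞_Lˣ}) = P_L ∩ ι(𝓘_K)`.
[cite: Rosen1997FLT, Appendix, proof of Thm. A2 ("D_L^G = im D_K")] -/
theorem map_z0_unitsE_eq [IsGalois K L] {σ : L ≃ₐ[K] L}
    (hσ : ∀ τ : L ≃ₐ[K] L, τ ∈ Subgroup.zpowers σ)
    (hunr : ∀ v : HeightOneSpectrum (𝓞 K), Algebra.IsUnramifiedIn (𝓞 L) v.asIdeal) :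
    (z0 σ ⊤ (unitsE L)).map (toPrincipalIdeal (𝓞 L) L) =
      principals L ⊓ (Units.map (extendedHom L (𝓞 L) :
        FractionalIdeal (𝓞 K)⁰ K →+* FractionalIdeal (𝓞 L)⁰ L).toMonoidHom).range := by
  apply le_antisymm
  · rintro _ ⟨y, hy, rfl⟩
    exact ⟨⟨y, rfl⟩, toPrincipalIdeal_mem_range_of_mem_z0 hσ hunr hy⟩
  · rintro I ⟨⟨y, rfl⟩, ⟨J, hJ⟩⟩
    refine ⟨y, mem_z0.mpr ⟨Subgroup.mem_top y, ?_⟩, rfl⟩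
    rw [← ker_toPrincipalIdeal_eq_unitsE, MonoidHom.mem_ker, map_div, toPrincipalIdeal_smul, ← hJ,
      smul_unitsMap_extendedHom, div_self']

end Count

end Literature.NumberTheory.NumberFields

end
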